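/-
Copyright (c) 2026 the pub-hodgecm2 formalisation cell (harness21).  New file, outside the frozen port manifest.  Origin: seat
`prover-pub-hodgecm2-d2bridge-end-1-g0-0` (VERSION-B item (1), END-file filer of record per the ASSEMBLER, HOME/INBOX l.11286, DECISIONS #12–#14),
2026-08-23.  THE END FILE: `HC_CM` from the END display's printed citations, the `h418` slot of the LOCALISED hM discharge (✔
`PortJoin/HMDischargeLocal.lean`) FILLED by the Δ2 bridge at the pinned dictionary of record — ONE application per `(F) (hG) (h6) (V) (hV) (a₀)` of
✔ `PinSignatures.thm418C_liuDictionaryPin_of_pins`; every pin not landed BY VALUE is displayed BY NAME in that theorem's binder types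
(RESIDUAL-SHORT).  KERNEL only: theorems, no `def`, no instance, no named fact, no `sorry`.  HC_CM is NOT proved; NOT «Δ2 BRIDGE CLOSED».
-/
import Summits.HodgeConjecture.CorCM.PortJoin.HMDischargeLocal
import Summits.HodgeConjecture.CorCM.D2Bridge.PinSignatures
import Summits.HodgeConjecture.CorCM.B01.Transposition.Item6UniformOmegaRep
import Summits.HodgeConjecture.CorCM.D2Bridge.OmegaAtDeltaPrime
import Literature.NumberTheory.GelbartRogawski1991.UnitaryDualPairThetaKernelCMKTypeFin
import Literature.NumberTheory.Automorphic.Liu2021.AppendixC.Prop413DataOfRestOne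
import Literature.NumberTheory.Automorphic.Liu2021.AppendixC.UniformOmegaCiteLegs
import Literature.NumberTheory.Automorphic.Liu2021.Def45RMuFormSupply
import Literature.AlgebraicGeometry.ComplexMultiplication.CMAbelianVarietyRealisedHolds
import HarnessLib

set_option autoImplicit false

/-!
# END: `HC_CM` from the printed citations — the `h418` slot filled by the Δ2 bridge at the pinned dictionary of record
§A0 [Lem D.1 (1)] ⇒ `ω ≠ 0` at the rests of record (F4 re-typed) · §A `thm418C_indexOfRecord_of_pins`: the bridge at
`liuDictionaryPin … V (I V (repAt a₀) (muLiu ι₁ rep)) (line …)` · §B `hc_cm_of_printed_citations`: the END term of record through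
✔ `Model.hc_cm_of_port_meeting_rec_local` at `h418 :=` §A.  References: Y. Liu, Camb. J. Math. 9 (2021) Thm 4.18 p. 52, Prop 4.13 p. 47,
Def 4.11 p. 46, Def 4.5 (2) p. 42, Lem D.1 (1),(3) pp. 125–126; Shimura 1998 Thm 21.4; Deligne 1979 2.2.5; Gelbart–Rogawski 1991 Prop 3.1.1.
-/

noncomputable section

open scoped TensorProduct Matrix

namespace Summit.HodgeConjecture.CorCM.PortJoin

open NumberField NumberField.InfinitePlace
open HodgeCM.Model HodgeCM.Model.LiuIndex HodgeCM.Model.TowerCarrier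
open HodgeCM.Literature.Theta.LiuAlbaneseModuleDatum.D2Bridge (HcmPieces)
open Summit.HodgeConjecture.CorCM.Model
open Literature.AlgebraicGeometry.Motives (CMType)
open Literature.AlgebraicGeometry.HodgeTheory Literature.NumberTheory.Automorphic.PicardCM
open Literature.AlgebraicGeometry.ShimuraVarieties.UnitaryCanonicalModel
open Literature.NumberTheory.ComplexMultiplication
open Literature.NumberTheory.Automorphic
open Literature.NumberTheory.Automorphic.IdeleClassGroup (toHeckeCharacter isUnitary_toHeckeCharacter)
open Literature.NumberTheory.Automorphic.Liu2021 Literature.NumberTheory.Automorphic.Liu2021.AppendixC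
open Literature.NumberTheory.Automorphic.Liu2021.AppendixC.RestOne
open Literature.NumberTheory.Automorphic.Liu2021.Def411WeilCarriers (lineOf locF Rep)
open Summit.HodgeConjecture.CorCM.Transposition.OmegaTransport (realUnit)
open HodgeCM.Model.ArchSideTerm (e₁)
open Literature.NumberTheory.GelbartRogawski1991 Literature.NumberTheory.GelbartRogawski1991.UnitaryDualPair
open Literature.NumberTheory.GelbartRogawski1991.UnitaryDualPair.LocalSplitting (localMu norm_localMu continuous_localMu localMu_toLocalRing_eq_one_iff)
open Literature.RepresentationTheory Literature.RepresentationTheory.Liu2021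
open Summit.HodgeConjecture.CorCM.Transposition


set_option quotPrecheck false
/-- the PINNED DICTIONARY OF RECORD at `(V, ι₁, a₀)` over the five `_holds` rows (the `h418` binder's dictionary, ✔ `PortJoin/Closed.lean`). -/
local notation "𝔇⟦" V "," ι₁ "," a₀ "⟧" =>
  liuDictionaryPin exists_isReal_hodgeModel_holds hodgePQ_independent_of_hodgeModel_holds BallQuotient.ballQuotientUniformised_holds
    (cmAbelianVarietyRealised_of_eigenbasis exists_isReal_hodgeModel_holds hodgePQ_independent_of_hodgeModel_holds
      cmAbelianVarietyEigenbasisRealised_holds)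
    Literature.NumberTheory.Transcendental.arapura2012_cor_15_4_6_holds V (I V (repAt a₀) (muLiu ι₁ GramClass.rep))
    (line V (repAt a₀) (muLiu ι₁ GramClass.rep))
/-- the App-C standing datum of record `sec42DataOf h isoOf F ι₁ V Φ` ([Liu21, §4.2 ∕ App. C]) at the ported codes. -/
local notation "ℭ⟦" h "," F "," ι₁ "," V "," Φ "⟧" =>
  sec42DataOf h isoOf ⟨HodgeCM.CMField.K F⟩ ι₁
    ⟨HodgeCM.HermSpace3.Hm V, HodgeCM.HermSpace3.isHermitian V, HodgeCM.HermSpace3.signature_ι₁ V, HodgeCM.HermSpace3.posDef_of_ne V⟩ Φ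
/-- the TAIL OF THE REST OF RECORD at `μ` ([Liu21, Def. 4.5 (2), 4.16, Rem. 4.17]): `restTailOne id ι₁ hμ hw (ofPolDR …) (𝒯.rhoΩOne …)`. -/
local notation "𝔱⟦" h "," h6 "," F "," ι₁ "," V "," Φ "," μ "," hμ "," hw "⟧" =>
  restTailOne (AlgHom.id ℚ _) ι₁ hμ hw (Def45.Carriers.ofPolDR μ (Def45.PolDR ι₁ hμ (Def45.RMuForm ι₁ hμ)))
    ((heckeTranslatesFamilyOf heckeTranslate_definedOver_holds h isoOf ⟨HodgeCM.CMField.K F⟩ ι₁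
      ⟨HodgeCM.HermSpace3.Hm V, HodgeCM.HermSpace3.isHermitian V, HodgeCM.HermSpace3.signature_ι₁ V, HodgeCM.HermSpace3.posDef_of_ne V⟩ Φ
      h6).rhoΩOne (AlgHom.id ℚ _) ι₁ hμ hw (Def45.Carriers.ofPolDR μ (Def45.PolDR ι₁ hμ (Def45.RMuForm ι₁ hμ))))
/-- the INDEX OF RECORD `LiuIndex.I V (repAt a₀) (muLiu ι₁ rep)` and its lines (port layer 69; the `h418` binder's enumeration). -/
local notation "𝕀⟦" V "," ι₁ "," a₀ "⟧" => I V (repAt a₀) (muLiu ι₁ GramClass.rep)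
local notation "𝕃⟦" V "," ι₁ "," a₀ "⟧" => line V (repAt a₀) (muLiu ι₁ GramClass.rep)
/-- `ℙ i`: Liu's `τ′ ∈ Φ_μ` at the line (`PhiMuLine ι₁ (line i)`); `𝔾 i`: the GOOD lines = continuous pair splitting (else `block i = ⊥`). -/
local notation "ℙ⟦" V "," ι₁ "," a₀ "," i "⟧" => SplitLine.PhiMuLine ι₁ (line V (repAt a₀) (muLiu ι₁ GramClass.rep) i)
local notation "𝔾⟦" V "," a₀ "," i "⟧" => Continuous (Subtype.val (Sigma.snd i) : SplittingAt V (repAt a₀ (Sigma.fst i)))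
/-- the representative section of record at the index line `i` (re-points Def. 4.12's collection at the package's line `⟨u_{a_i}⟩`). -/
local notation "𝕣⟦" F "," a₀ "," i "⟧" =>
  Rep.update ↥(maximalRealSubfield (HodgeCM.CMField.K F)) (imagUnitSq (HodgeCM.CMField.K F))
    (Rep.ofLineOf ↥(maximalRealSubfield (HodgeCM.CMField.K F)) (imagUnitSq (HodgeCM.CMField.K F)))
    (locF ↥(maximalRealSubfield (HodgeCM.CMField.K F)) (imagUnitSq (HodgeCM.CMField.K F))
      (realUnit ⟨HodgeCM.CMField.K F⟩ (repAt a₀ (Sigma.fst i)).1 (repAt a₀ (Sigma.fst i)).2.1 (repAt a₀ (Sigma.fst i)).2.2))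
    (realUnit ⟨HodgeCM.CMField.K F⟩ (repAt a₀ (Sigma.fst i)).1 (repAt a₀ (Sigma.fst i)).2.1 (repAt a₀ (Sigma.fst i)).2.2) rfl
/-- the μ-UNIFORM WEIL CARRIERS OF RECORD at the index line `i` (own-htheta ✔ `Model.uniformOmegaRep` at `δ′ = (2δ_F)⁻¹`, section 𝕣). -/
local notation "𝕌⟦" h "," F "," ι₁ "," V "," Φ "," a₀ "," i "⟧" =>
  uniformOmegaRep h ⟨HodgeCM.CMField.K F⟩ ι₁
    ⟨HodgeCM.HermSpace3.Hm V, HodgeCM.HermSpace3.isHermitian V, HodgeCM.HermSpace3.signature_ι₁ V, HodgeCM.HermSpace3.posDef_of_ne V⟩ Φ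
    e₁ (frameD V) (frameD_real V) (frameD_ne V) (ιVE V) (2 * imagUnit (HodgeCM.CMField.K F))⁻¹ (fun _ _ => 𝕣⟦F, a₀, i⟧)
/-- LIU'S OWN δ′ REST OF RECORD at `(i, μ)`: F4's `restOfCharDeltaPrime` (δ′ = (2δ_F)⁻¹ EXACT) at `(e₁, frameD V, ιVE V, 𝕣 i)`; `= (𝕌 i).rest (restTailOne …)` (`rfl`). -/
local notation "𝔯⟦" h "," h6 "," F "," ι₁ "," V "," Φ "," a₀ "," i "," μ "," hμ "," hw "⟧" =>
  restOfCharDeltaPrime h ⟨HodgeCM.CMField.K F⟩ h6 ι₁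
    ⟨HodgeCM.HermSpace3.Hm V, HodgeCM.HermSpace3.isHermitian V, HodgeCM.HermSpace3.signature_ι₁ V, HodgeCM.HermSpace3.posDef_of_ne V⟩ Φ
    e₁ (frameD V) (frameD_real V) (frameD_ne V) (ιVE V) 𝕣⟦F, a₀, i⟧ μ hμ hw


/-! ## §A  The Δ2 bridge at the pinned dictionary of record -/

set_option synthInstance.maxHeartbeats 400000 in
set_option maxHeartbeats 8000000 in
/-- **§A The Δ2 bridge at the pinned dictionary of record** (`F` Galois CM, `6 ≤ [F:ℚ]`): `Thm418C` from the printed citations at the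
CONSTRUCTED objects — per index line `i` with continuous pair splitting and conjugate-symplectic weight-one `μ`: `hLiu'` [Liu21, Thm 4.18] AS
PRINTED at Liu's own δ′ rest of record `restOfCharDeltaPrime … (2δ_F)⁻¹ 𝕣 μ …` (F4; `= (𝕌 i).rest (restTailOne …)` by `rfl`; READING r8), `h411` [Def 4.11], `h413`
[Prop 4.13] at the tower, `hμsep` [Lem D.1 (3)] cross-`μ` leg, `hD1'` [Lem D.1 (1)] per place
— BY VALUE: `𝕌 i` (✔ `uniformOmegaRep` at δ′, section `𝕣 i`), `restTailOne …`, `Ks := Level.capThree C.S.K₀`, `hK := C.S.K₀`; BY NAME (DECISION #13): (b) the Ω-slot `hΩ`, `hbad`, (c) `M ∕ jH ∕ hjHinj ∕ hjH`, (d) `pieces`.  ONE application of ✔ `PinSignatures.thm418C_liuDictionaryPin_of_pins`;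
its `h411 ∕ hsep` DERIVED (✔ `UniformOmega.adjectives_rhoAt_prop413Data_of_def411AsPrinted_rest` ∕ `…admTriple_eq_of_areIsomorphic_of_thm418AsPrinted_rest`).
HC_CM is NOT proved here.  [cite: Liu2021, Thm. 4.18 (FJcycle.tex l. 2232–2245), Prop. 4.13 (l. 2113–2119), Def. 4.11, App. D Lem. D.1 (1),(3)]
[cite: GelbartRogawski1991, §3.1 Prop. 3.1.1 p. 455 L1–3, Remark p. 457 L4–13] -/
theorem thm418C_indexOfRecord_of_pins (F : HodgeCM.CMField) [IsGalois ℚ (F : Type)] (h6 : 6 ≤ Module.finrank ℚ (F : Type))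
    {ι₁ : (F : Type) →+* ℂ} (V : HodgeCM.HermSpace3 F ι₁) (a₀ : RealScalar F) (h : exists_recordSystem)
    (Φ : CMType (F : Type))
    -- PIN by name: block vanishing off the index lines with continuous pair splitting (✔ p370342 `Item6PinBlockVanishing` + p371180, oleans owed)
    (hbad : ∀ (i : 𝕀⟦V, ι₁, a₀⟧), ℙ⟦V, ι₁, a₀, i⟧ → ¬ 𝔾⟦V, a₀, i⟧ → (𝔇⟦V, ι₁, a₀⟧).block i = ⊥)
    -- (b) PIN by name: the Ω-slot at the index of record (prove-7 `LiuIndex.OmegaPin.exists_pinTerms_indexOfRecord`, behind prove-6 ∕ F4 ∕ pin-3)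
    (hΩ : ∃ (μ : ∀ i : 𝕀⟦V, ι₁, a₀⟧, ℙ⟦V, ι₁, a₀, i⟧ → 𝔾⟦V, a₀, i⟧ → (Literature.NumberTheory.Automorphic.IdeleClassGroup (F : Type) →ₜ* Circle))
      (hμ : ∀ (i : 𝕀⟦V, ι₁, a₀⟧) (hi : ℙ⟦V, ι₁, a₀, i⟧) (hg : 𝔾⟦V, a₀, i⟧), IdeleClassGroup.IsConjugateSymplectic (F : Type) (μ i hi hg))
      (hw : ∀ (i : 𝕀⟦V, ι₁, a₀⟧) (hi : ℙ⟦V, ι₁, a₀, i⟧) (hg : 𝔾⟦V, a₀, i⟧), IdeleClassGroup.HasWeight (F : Type) (μ i hi hg) 1)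
      (σ : ∀ (i : 𝕀⟦V, ι₁, a₀⟧) (hi : ℙ⟦V, ι₁, a₀, i⟧) (hg : 𝔾⟦V, a₀, i⟧), {χ : (𝕃⟦V, ι₁, a₀⟧ i).CharW // (𝕃⟦V, ι₁, a₀⟧ i).IsAutChar χ} → (toThm418Data _ ((𝕌⟦h, F, ι₁, V, Φ, a₀, i⟧).rest 𝔱⟦h, h6, F, ι₁, V, Φ, μ i hi hg, hμ i hi hg, hw i hi hg⟧)).AdmIndex)
      (e : ∀ (i : 𝕀⟦V, ι₁, a₀⟧) (hi : ℙ⟦V, ι₁, a₀, i⟧) (hg : 𝔾⟦V, a₀, i⟧) (a : {χ : (𝕃⟦V, ι₁, a₀⟧ i).CharW // (𝕃⟦V, ι₁, a₀⟧ i).IsAutChar χ}), (𝕃⟦V, ι₁, a₀⟧ i).Ω (ιVE V) a.1 ≃ₗ[ℂ] (toThm418Data _ ((𝕌⟦h, F, ι₁, V, Φ, a₀, i⟧).rest 𝔱⟦h, h6, F, ι₁, V, Φ, μ i hi hg, hμ i hi hg, hw i hi hg⟧)).omegaAt (σ i hi hg a)),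
      (∀ (i : 𝕀⟦V, ι₁, a₀⟧) (hi : ℙ⟦V, ι₁, a₀, i⟧) (hg : 𝔾⟦V, a₀, i⟧), IdeleClassGroup.HasCMType (F : Type) (μ i hi hg) (𝕃⟦V, ι₁, a₀⟧ i).lineType) ∧ (∀ (i : 𝕀⟦V, ι₁, a₀⟧) (hi : ℙ⟦V, ι₁, a₀, i⟧) (hg : 𝔾⟦V, a₀, i⟧), Function.Injective (σ i hi hg)) ∧
      (∀ (i : 𝕀⟦V, ι₁, a₀⟧) (hi : ℙ⟦V, ι₁, a₀, i⟧) (hg : 𝔾⟦V, a₀, i⟧) (a : {χ : (𝕃⟦V, ι₁, a₀⟧ i).CharW // (𝕃⟦V, ι₁, a₀⟧ i).IsAutChar χ}) (g : ↥V.adelicFin) (m : (𝕃⟦V, ι₁, a₀⟧ i).Ω (ιVE V) a.1),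
          e i hi hg a (MonoidAlgebra.of ℂ ↥V.adelicFin g • m) = (toThm418Data _ ((𝕌⟦h, F, ι₁, V, Φ, a₀, i⟧).rest 𝔱⟦h, h6, F, ι₁, V, Φ, μ i hi hg, hμ i hi hg, hw i hi hg⟧)).rhoAt (σ i hi hg a) g (e i hi hg a m)))
    -- [Liu21, Thm 4.18] AS PRINTED at the rests of record = F4's `restOfCharDeltaPrime … (2δ_F)⁻¹ 𝕣 μ …` (Liu's own δ′ rest; `= (𝕌 i).rest (restTailOne …)` by `rfl`) — a READING r8
    (hLiu' : ∀ (i : 𝕀⟦V, ι₁, a₀⟧) (μ : Literature.NumberTheory.Automorphic.IdeleClassGroup (F : Type) →ₜ* Circle)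
      (hμ : IdeleClassGroup.IsConjugateSymplectic (F : Type) μ) (hw : IdeleClassGroup.HasWeight (F : Type) μ 1),
      Thm418AsPrinted (toThm418Data _ 𝔯⟦h, h6, F, ι₁, V, Φ, a₀, i, μ, hμ, hw⟧))
    -- [Liu21, Def 4.11] AS PRINTED at the rests of record
    (h411 : ∀ (i : 𝕀⟦V, ι₁, a₀⟧) (μ : Literature.NumberTheory.Automorphic.IdeleClassGroup (F : Type) →ₜ* Circle)
      (hμ : IdeleClassGroup.IsConjugateSymplectic (F : Type) μ) (hw : IdeleClassGroup.HasWeight (F : Type) μ 1),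
      Def411AsPrinted (toThm418Data _ 𝔯⟦h, h6, F, ι₁, V, Φ, a₀, i, μ, hμ, hw⟧))
    -- [Liu21, Prop 4.13] AS PRINTED at the tower `(𝔇).H` over the uniform carriers of the line
    (h413 : ∀ (i : 𝕀⟦V, ι₁, a₀⟧), Prop413AsPrinted ((𝕌⟦h, F, ι₁, V, Φ, a₀, i⟧).prop413Data (𝔇⟦V, ι₁, a₀⟧).H))
    -- the cross-μ leg of [Liu21, App. D Lem D.1 (3)] («μ = ⊗_v μ_v»): isomorphic non-zero summands have the same μ
    (hμsep : ∀ (i : 𝕀⟦V, ι₁, a₀⟧) (s t : ((𝕌⟦h, F, ι₁, V, Φ, a₀, i⟧).prop413Data (𝔇⟦V, ι₁, a₀⟧).H).AdmTriple), Nontrivial (((𝕌⟦h, F, ι₁, V, Φ, a₀, i⟧).prop413Data (𝔇⟦V, ι₁, a₀⟧).H).omegaAt s) →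
      (∃ f : ((𝕌⟦h, F, ι₁, V, Φ, a₀, i⟧).prop413Data (𝔇⟦V, ι₁, a₀⟧).H).omegaAt s ≃ₗ[ℂ] ((𝕌⟦h, F, ι₁, V, Φ, a₀, i⟧).prop413Data (𝔇⟦V, ι₁, a₀⟧).H).omegaAt t,
        ∀ (g : ↥V.adelicFin) (v : ((𝕌⟦h, F, ι₁, V, Φ, a₀, i⟧).prop413Data (𝔇⟦V, ι₁, a₀⟧).H).omegaAt s), f (((𝕌⟦h, F, ι₁, V, Φ, a₀, i⟧).prop413Data (𝔇⟦V, ι₁, a₀⟧).H).rhoAt s g v) = ((𝕌⟦h, F, ι₁, V, Φ, a₀, i⟧).prop413Data (𝔇⟦V, ι₁, a₀⟧).H).rhoAt t g (f v)) → s.1.μ = t.1.μ)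
    -- [Liu21, App. D Lem D.1 (1)] AS PRINTED per place at the local data of the rests of record (F4's `hD1` shape, 𝕌-currency; gives `ω ≠ 0` via §A0)
    (hD1' : ∀ (i : 𝕀⟦V, ι₁, a₀⟧) (μ : Literature.NumberTheory.Automorphic.IdeleClassGroup (F : Type) →ₜ* Circle)
      (hμ : IdeleClassGroup.IsConjugateSymplectic (F : Type) μ) (hw : IdeleClassGroup.HasWeight (F : Type) μ 1) (hΦμ : IdeleClassGroup.HasCMType (F : Type) μ (𝕃⟦V, ι₁, a₀⟧ i).lineType)
      (j : (toThm418Data _ 𝔯⟦h, h6, F, ι₁, V, Φ, a₀, i, μ, hμ, hw⟧).AdmIndex) (v : IsDedekindDomain.HeightOneSpectrum (𝓞 ↥(maximalRealSubfield (F : Type)))),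
      LemD1_1AsPrinted
        (Def411WeilCarriers.localLemD1Data ↥(maximalRealSubfield (F : Type)) (F : Type) (IsCMField.complexConj (F : Type)) 3 e₁
          (Matrix.diagonal (frameD V)) (complexConj_imagUnit (F : Type)) (imagUnit_ne_zero (F : Type)) (imagUnit_mul_self (F : Type))
          (realDiagonal_isSymm (F : Type) (frameD V) (frameD_real V)) (isUnit_det_realDiagonal (F : Type) (frameD V) (frameD_real V) (frameD_ne V))
          (realDiagonal_map (F : Type) (frameD V) (frameD_real V)).symm ((𝕣⟦F, a₀, i⟧).toFun j.1.1)
          (OmegaChiSplitting.chiLocalSplittingsD ⟨HodgeCM.CMField.K F⟩ e₁ (frameD V) (frameD_real V) (frameD_ne V) (toHeckeCharacter (F : Type) μ)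
            ((isOscillatorChar_toHeckeCharacter_iff μ).mpr hμ) ((𝕣⟦F, a₀, i⟧).toFun j.1.1))
          (le_refl 3) (localMu (F : Type) (toHeckeCharacter (F : Type) μ))
          (fun v x => norm_localMu (F : Type) (toHeckeCharacter (F : Type) μ) v (isUnitary_toHeckeCharacter (F : Type) μ) x)
          (continuous_localMu (F : Type) (toHeckeCharacter (F : Type) μ))
          (fun v t => localMu_toLocalRing_eq_one_iff (F : Type) (toHeckeCharacter (F : Type) μ) v ((isOscillatorChar_toHeckeCharacter_iff μ).mpr hμ) t)
          j.1.2.1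
          (Def411WeilCarriers.norm_chi_eq_one ↥(maximalRealSubfield (F : Type)) (F : Type) (IsCMField.complexConj (F : Type))
            (Algebra.IsQuadraticExtension.finrank_eq_two ↥(maximalRealSubfield (F : Type)) (F : Type))
            (UnitaryGroup.algEquiv_ne_one_of_apply_eq_neg ↥(maximalRealSubfield (F : Type)) (F : Type) (IsCMField.complexConj (F : Type))
              (complexConj_imagUnit (F : Type)) (imagUnit_ne_zero (F : Type))) j.1.2)
          j.1.2.2.1 v))
    -- (c) RESIDUAL by name (DECISION #13, keyed at `Φ_μ = (line i).lineType` per referee F2): the J record in PinSignatures' abstract currency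
    (M : ∀ (i : 𝕀⟦V, ι₁, a₀⟧) (μ : Literature.NumberTheory.Automorphic.IdeleClassGroup (F : Type) →ₜ* Circle)
      (hμ : IdeleClassGroup.IsConjugateSymplectic (F : Type) μ) (hw : IdeleClassGroup.HasWeight (F : Type) μ 1) (hΦμ : IdeleClassGroup.HasCMType (F : Type) μ (𝕃⟦V, ι₁, a₀⟧ i).lineType),
      (toThm418Data _ ((𝕌⟦h, F, ι₁, V, Φ, a₀, i⟧).rest 𝔱⟦h, h6, F, ι₁, V, Φ, μ, hμ, hw⟧)).Map43RationalData)
    (jH : ∀ (i : 𝕀⟦V, ι₁, a₀⟧) (μ : Literature.NumberTheory.Automorphic.IdeleClassGroup (F : Type) →ₜ* Circle)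
      (hμ : IdeleClassGroup.IsConjugateSymplectic (F : Type) μ) (hw : IdeleClassGroup.HasWeight (F : Type) μ 1) (hΦμ : IdeleClassGroup.HasCMType (F : Type) μ (𝕃⟦V, ι₁, a₀⟧ i).lineType),
      (M i μ hμ hw hΦμ).HB →ₗ[ℂ] (𝔇⟦V, ι₁, a₀⟧).H)
    (hjHinj : ∀ (i : 𝕀⟦V, ι₁, a₀⟧) (μ : Literature.NumberTheory.Automorphic.IdeleClassGroup (F : Type) →ₜ* Circle)
      (hμ : IdeleClassGroup.IsConjugateSymplectic (F : Type) μ) (hw : IdeleClassGroup.HasWeight (F : Type) μ 1) (hΦμ : IdeleClassGroup.HasCMType (F : Type) μ (𝕃⟦V, ι₁, a₀⟧ i).lineType),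
      Function.Injective (jH i μ hμ hw hΦμ))
    (hjH : ∀ (i : 𝕀⟦V, ι₁, a₀⟧) (μ : Literature.NumberTheory.Automorphic.IdeleClassGroup (F : Type) →ₜ* Circle)
      (hμ : IdeleClassGroup.IsConjugateSymplectic (F : Type) μ) (hw : IdeleClassGroup.HasWeight (F : Type) μ 1) (hΦμ : IdeleClassGroup.HasCMType (F : Type) μ (𝕃⟦V, ι₁, a₀⟧ i).lineType) (g : ↥V.adelicFin) (x : (M i μ hμ hw hΦμ).HB),
      jH i μ hμ hw hΦμ ((M i μ hμ hw hΦμ).ρB g x) = MonoidAlgebra.of ℂ ↥V.adelicFin g • jH i μ hμ hw hΦμ x)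
    -- (d) RESIDUAL by name (DECISION #13): the pieces below the threshold `Level.capThree C.S.K₀`
    (pieces : ∀ (i : 𝕀⟦V, ι₁, a₀⟧) (μ : Literature.NumberTheory.Automorphic.IdeleClassGroup (F : Type) →ₜ* Circle)
      (hμ : IdeleClassGroup.IsConjugateSymplectic (F : Type) μ) (hw : IdeleClassGroup.HasWeight (F : Type) μ 1) (hΦμ : IdeleClassGroup.HasCMType (F : Type) μ (𝕃⟦V, ι₁, a₀⟧ i).lineType) (K : HodgeCM.Level V),
      K ≤ HodgeCM.Level.capThree (V := V) ((ℭ⟦h, F, ι₁, V, Φ⟧).S.K₀.1 : Subgroup ↥V.adelicFin) (ℭ⟦h, F, ι₁, V, Φ⟧).S.K₀.2.1 →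
      HcmPieces.{0, 1, 0} (toThm418Data _ ((𝕌⟦h, F, ι₁, V, Φ, a₀, i⟧).rest 𝔱⟦h, h6, F, ι₁, V, Φ, μ, hμ, hw⟧)) (M i μ hμ hw hΦμ) (𝔇⟦V, ι₁, a₀⟧).H (jH i μ hμ hw hΦμ) K.K
        ((HodgeCM.Model.picardCMUniverse exists_isReal_hodgeModel_holds hodgePQ_independent_of_hodgeModel_holds
            BallQuotient.ballQuotientUniformised_holds
            (cmAbelianVarietyRealised_of_eigenbasis exists_isReal_hodgeModel_holds hodgePQ_independent_of_hodgeModel_holds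
              cmAbelianVarietyEigenbasisRealised_holds)).CohC
          ((HodgeCM.Model.picardCMUniverse exists_isReal_hodgeModel_holds hodgePQ_independent_of_hodgeModel_holds
            BallQuotient.ballQuotientUniformised_holds
            (cmAbelianVarietyRealised_of_eigenbasis exists_isReal_hodgeModel_holds hodgePQ_independent_of_hodgeModel_holds
              cmAbelianVarietyEigenbasisRealised_holds)).pms F ι₁ V K) 1)
        (resTotal exists_isReal_hodgeModel_holds hodgePQ_independent_of_hodgeModel_holds
          (ballQuotientUniformisedDatum_of BallQuotient.ballQuotientUniformised_holds)
          (cmAbelianVarietyRealised_of_eigenbasis exists_isReal_hodgeModel_holds hodgePQ_independent_of_hodgeModel_holds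
            cmAbelianVarietyEigenbasisRealised_holds)
          Literature.NumberTheory.Transcendental.arapura2012_cor_15_4_6_holds K)
        ((𝔇⟦V, ι₁, a₀⟧).cmClasses K i)) :
    (𝔇⟦V, ι₁, a₀⟧).Thm418C := by
  -- F4's δ′ rest of record IS the rest assembled from the uniform carriers and the one-object tail (own-htheta ✔ `restOfCharRep_eq_rest`, `rfl`)
  have eR : ∀ (i : 𝕀⟦V, ι₁, a₀⟧) (μ : Literature.NumberTheory.Automorphic.IdeleClassGroup (F : Type) →ₜ* Circle)
      (hμ : IdeleClassGroup.IsConjugateSymplectic (F : Type) μ) (hw : IdeleClassGroup.HasWeight (F : Type) μ 1),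
      𝔯⟦h, h6, F, ι₁, V, Φ, a₀, i, μ, hμ, hw⟧ = (𝕌⟦h, F, ι₁, V, Φ, a₀, i⟧).rest 𝔱⟦h, h6, F, ι₁, V, Φ, μ, hμ, hw⟧ := fun i μ hμ hw =>
    restOfCharRep_eq_rest h ⟨HodgeCM.CMField.K F⟩ ι₁ ⟨HodgeCM.HermSpace3.Hm V, HodgeCM.HermSpace3.isHermitian V, HodgeCM.HermSpace3.signature_ι₁ V, HodgeCM.HermSpace3.posDef_of_ne V⟩ Φ
      e₁ (frameD V) (frameD_real V) (frameD_ne V) (ιVE V) (2 * imagUnit (F : Type))⁻¹ (fun _ _ => 𝕣⟦F, a₀, i⟧) h6 μ hμ hw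
  -- the displayed cites, moved from Liu's δ′ rest to the pin theorem's currency along `eR` (transport of a `Prop`, no re-typing)
  have hLiuU : ∀ (i : 𝕀⟦V, ι₁, a₀⟧) (μ : Literature.NumberTheory.Automorphic.IdeleClassGroup (F : Type) →ₜ* Circle)
      (hμ : IdeleClassGroup.IsConjugateSymplectic (F : Type) μ) (hw : IdeleClassGroup.HasWeight (F : Type) μ 1),
      Thm418AsPrinted (toThm418Data _ ((𝕌⟦h, F, ι₁, V, Φ, a₀, i⟧).rest 𝔱⟦h, h6, F, ι₁, V, Φ, μ, hμ, hw⟧)) := fun i μ hμ hw => eR i μ hμ hw ▸ hLiu' i μ hμ hw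
  have h411U : ∀ (i : 𝕀⟦V, ι₁, a₀⟧) (μ : Literature.NumberTheory.Automorphic.IdeleClassGroup (F : Type) →ₜ* Circle)
      (hμ : IdeleClassGroup.IsConjugateSymplectic (F : Type) μ) (hw : IdeleClassGroup.HasWeight (F : Type) μ 1),
      Def411AsPrinted (toThm418Data _ ((𝕌⟦h, F, ι₁, V, Φ, a₀, i⟧).rest 𝔱⟦h, h6, F, ι₁, V, Φ, μ, hμ, hw⟧)) := fun i μ hμ hw => eR i μ hμ hw ▸ h411 i μ hμ hw
  -- [Lem D.1 (1)] ⇒ `ω ≠ 0` (F4 ✔ `nontrivial_omegaAt_restOfCharDeltaPrime_of_lemD1AsPrinted`; `ιVE V` onto, `n = 3`), moved along `eR`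
  have hnvU : ∀ (i : 𝕀⟦V, ι₁, a₀⟧) (μ : Literature.NumberTheory.Automorphic.IdeleClassGroup (F : Type) →ₜ* Circle)
      (hμ : IdeleClassGroup.IsConjugateSymplectic (F : Type) μ) (hw : IdeleClassGroup.HasWeight (F : Type) μ 1) (hΦμ : IdeleClassGroup.HasCMType (F : Type) μ (𝕃⟦V, ι₁, a₀⟧ i).lineType),
      ∀ j : (toThm418Data _ ((𝕌⟦h, F, ι₁, V, Φ, a₀, i⟧).rest 𝔱⟦h, h6, F, ι₁, V, Φ, μ, hμ, hw⟧)).AdmIndex, Nontrivial ((toThm418Data _ ((𝕌⟦h, F, ι₁, V, Φ, a₀, i⟧).rest 𝔱⟦h, h6, F, ι₁, V, Φ, μ, hμ, hw⟧)).omegaAt j) := fun i μ hμ hw hΦμ =>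
    eR i μ hμ hw ▸ fun j => nontrivial_omegaAt_restOfCharDeltaPrime_of_lemD1AsPrinted h ⟨HodgeCM.CMField.K F⟩ h6 ι₁
      ⟨HodgeCM.HermSpace3.Hm V, HodgeCM.HermSpace3.isHermitian V, HodgeCM.HermSpace3.signature_ι₁ V, HodgeCM.HermSpace3.posDef_of_ne V⟩ Φ e₁ (frameD V)
      (frameD_real V) (frameD_ne V) (ιVE V) 𝕣⟦F, a₀, i⟧ μ hμ hw
      (UnitaryDualPair.finPart_cmKTypeHom_finAdelicToAdelic_surjective (F : Type) V.Hm (frameG V) (frameD V) (frame_congr V)) (le_refl 3) j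
      (hD1' i μ hμ hw hΦμ j)
  obtain ⟨μ, hμ, hw, σ, e, hcm, hσ, he⟩ := hΩ
  exact Summit.HodgeConjecture.CorCM.D2Bridge.PinSignatures.thm418C_liuDictionaryPin_of_pins V (𝕀⟦V, ι₁, a₀⟧) (𝕃⟦V, ι₁, a₀⟧) h Φ
    ℭ⟦h, F, ι₁, V, Φ⟧ (fun i => Continuous (i.2.1 : SplittingAt V (repAt a₀ i.1)))
    hbad
    (fun i _ _ => 𝕌⟦h, F, ι₁, V, Φ, a₀, i⟧)
    (fun i hi hg => (𝕌⟦h, F, ι₁, V, Φ, a₀, i⟧).rest 𝔱⟦h, h6, F, ι₁, V, Φ, μ i hi hg, hμ i hi hg, hw i hi hg⟧)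
    (fun i hi hg => 𝔱⟦h, h6, F, ι₁, V, Φ, μ i hi hg, hμ i hi hg, hw i hi hg⟧)
    (fun i hi hg => hLiuU i (μ i hi hg) (hμ i hi hg) (hw i hi hg)) σ hσ e he
    (fun i hi hg => M i (μ i hi hg) (hμ i hi hg) (hw i hi hg) (hcm i hi hg))
    (fun i hi hg => jH i (μ i hi hg) (hμ i hi hg) (hw i hi hg) (hcm i hi hg))
    (fun i hi hg => hjHinj i (μ i hi hg) (hμ i hi hg) (hw i hi hg) (hcm i hi hg))
    (fun i hi hg => hjH i (μ i hi hg) (hμ i hi hg) (hw i hi hg) (hcm i hi hg))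
    (fun _ => HodgeCM.Level.capThree (V := V) ((ℭ⟦h, F, ι₁, V, Φ⟧).S.K₀.1 : Subgroup ↥V.adelicFin) (ℭ⟦h, F, ι₁, V, Φ⟧).S.K₀.2.1)
    (fun i hi hg K hK => pieces i (μ i hi hg) (hμ i hi hg) (hw i hi hg) (hcm i hi hg) K hK)
    (fun i hi hg j => hnvU i (μ i hi hg) (hμ i hi hg) (hw i hi hg) (hcm i hi hg) j)
    (fun i _ _ => h413 i)
    (fun i _ _ => (𝕌⟦h, F, ι₁, V, Φ, a₀, i⟧).adjectives_rhoAt_prop413Data_of_def411AsPrinted_rest _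
      (fun μ hμ hw => 𝔱⟦h, h6, F, ι₁, V, Φ, μ, hμ, hw⟧) (h411U i))
    (fun i _ _ => (𝕌⟦h, F, ι₁, V, Φ, a₀, i⟧).admTriple_eq_of_areIsomorphic_of_thm418AsPrinted_rest _
      (fun μ hμ hw => 𝔱⟦h, h6, F, ι₁, V, Φ, μ, hμ, hw⟧) (hLiuU i) (hμsep i))
    ⟨(ℭ⟦h, F, ι₁, V, Φ⟧).S.K₀.1, (ℭ⟦h, F, ι₁, V, Φ⟧).S.K₀.2⟩

/-! ## §B  THE END: `HC_CM` from the printed citations — ✔ `Model.hc_cm_of_port_meeting_rec_local` at `h418 :=` §A -/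

set_option synthInstance.maxHeartbeats 400000 in
set_option maxHeartbeats 6400000 in
/-- **THE END — `HC_CM` FROM THE PRINTED CITATIONS (RESIDUAL-SHORT, ASSEMBLER DECISIONS #12–#14).**  Displayed: `h` [Deligne 1979,
2.1.2 ∕ 2.2.5 ∕ Cor. 2.7.21] the canonical model; `hLiu` [Liu 2021, Thm. 4.18] AS PRINTED at the constructed §4.2∕App-C rest `restOne …` and
`hLiu'` at the rests of record `restOfCharDeltaPrime … (2δ_F)⁻¹ …` of the pinned dictionary (per index line `i`, every conjugate-symplectic
weight-one `μ`) — READINGS r8 of the printed theorem at the constructed objects; `h21` [Shimura 1998, Thm. 21.4]; `hD1` ∕ `hD1'` [Liu 2021,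
App. D Lem. D.1 (1)] AS PRINTED per place at the two local data; `h411` [Def. 4.11]; `h413` [Prop. 4.13] AS PRINTED at the tower; `hμsep` (the
cross-`μ` leg of [App. D Lem. D.1 (3)]); and BY NAME the Δ2 RESIDUAL (DECISION #13, PinSignatures' abstract currency, keyed at the Ω-slot's
`μ_i`: `Φ_μ = (line i).lineType`): (c) the J record `M ∕ jH ∕ hjHinj ∕ hjH`, (d) the `pieces` below `Level.capThree C.S.K₀`; (b) the Ω-slot `hΩ`; `hbad`.
Every Δ2 family is keyed `ι₁ ∈ Φ` (referee F1).  CAVEAT (DECISION #14, MANDATORY): the orientation of the J-record ∕ pieces residual — and of the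
dictionary's admissibility clause `PhiMu ∕ adm` keyed at `ι₁` — relative to the complex structure of the tower (pin `ῑ₁`) is UNDER AUDIT
(ORIENTATION-MEMO v1.1 §3: one complex conjugation between two kernel-checked halves; fork (c-A)∕(c-S); test T3 pending); the residual family is
NOT shown inhabited here (referee R3) — ORIENTATION-MEMO v1.3 §0: «the by-name family {M, jH, hjHinj, hjH, pieces} is jointly inhabitable only
if every PhiMu block vanishes — orientation inconsistency between Stage-1's dictionary keyed at ι₁ and the PATH A pin along ῑ₁, under adjudication».  KERNEL: the END term of record (pointer #7 ✔ p335946) through the LOCALISED hM discharge ✔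
`Model.hc_cm_of_port_meeting_rec_local` (binder texts of `h ∕ hLiu ∕ h21 ∕ hD1` = ✔ `HMDischarge.lean` :295–:321 VERBATIM) at `h418 :=` §A per
`(F) (hG) (h6) (V) (hV) (a₀)` at the CM type `Φ_{-1} ∋ ι₁`.  HC_CM is NOT proved unconditionally: nothing displayed is inhabited here; NOT «Δ2
BRIDGE CLOSED»; hLiu = READING r8 until the bridge closes sorry-free and the referee signs.
[cite: Liu2021, Thm. 4.18 (FJcycle.tex l. 2232–2245), Prop. 4.13 (l. 2113–2119), Def. 4.11 (l. 2083–2097), App. D Lem. D.1 (1),(3) (l. 5226–5233)]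
[cite: Shimura1998, §21.4 Thm. 21.4] [cite: Deligne1979ShimuraVarieties, §2.1.2, 2.2.5 and Cor. 2.7.21] [cite: GelbartRogawski1991, §3.1 Prop. 3.1.1] -/
theorem hc_cm_of_printed_citations
    (h : exists_recordSystem)
    (hLiu : ∀ (F : CMField) [IsGalois ℚ F] (h6 : 6 ≤ Module.finrank ℚ F) (Φ : CMType F) (ι₁ : F →+* ℂ), ι₁ ∈ Φ.1 →
      ∀ V : HermSpace3 F ι₁, Thm418AsPrintedC (sec42DataOf h isoOf F ι₁ V Φ)
        (restOne (sec42DataOf h isoOf F ι₁ V Φ) (AlgHom.id ℚ F) ι₁ (isConjugateSymplectic_muOfInvType ι₁ Φ) (hasWeight_one_muOfInvType ι₁ Φ) (Def45.Carriers.ofPolDR (muOfInvType ι₁ Φ) (Def45.PolDR ι₁ (isConjugateSymplectic_muOfInvType ι₁ Φ) (Def45.RMuForm ι₁ (isConjugateSymplectic_muOfInvType ι₁ Φ))))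
            (Def411WeilCarriers.Eps ↥(maximalRealSubfield F) (imagUnitSq F)) (Def411WeilCarriers.epsOf ↥(maximalRealSubfield F) (imagUnitSq F) F (imagUnit F)) (Def411WeilCarriers.Chi ↥(maximalRealSubfield F) F (IsCMField.complexConj F))
            (Def411WeilCarriers.omega ↥(maximalRealSubfield F) F (IsCMField.complexConj F) 3 finProdFinEquiv (Matrix.diagonal V.diagEntries) (complexConj_imagUnit F) (imagUnit_ne_zero F) (imagUnit_mul_self F) (realDiagonal_isSymm F V.diagEntries V.complexConj_diagEntries) (isUnit_det_realDiagonal F V.diagEntries V.complexConj_diagEntries V.diagEntries_ne_zero) (realDiagonal_map F V.diagEntries V.complexConj_diagEntries).symm (OmegaMuSplitting.hsMu F ι₁ V Φ))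
            (Def411WeilCarriers.rho ↥(maximalRealSubfield F) F (IsCMField.complexConj F) 3 finProdFinEquiv (Matrix.diagonal V.diagEntries) (complexConj_imagUnit F) (imagUnit_ne_zero F) (imagUnit_mul_self F) (realDiagonal_isSymm F V.diagEntries V.complexConj_diagEntries) (isUnit_det_realDiagonal F V.diagEntries V.complexConj_diagEntries V.diagEntries_ne_zero) (realDiagonal_map F V.diagEntries V.complexConj_diagEntries).symm (OmegaMuSplitting.hsMu F ι₁ V Φ) V.adelicFinDiag.toMulEquiv.toMonoidHom) ((heckeTranslatesFamilyOf heckeTranslate_definedOver_holds h isoOf F ι₁ V Φ h6).rhoΩOne (AlgHom.id ℚ F) ι₁ (isConjugateSymplectic_muOfInvType ι₁ Φ) (hasWeight_one_muOfInvType ι₁ Φ) (Def45.Carriers.ofPolDR (muOfInvType ι₁ Φ) (Def45.PolDR ι₁ (isConjugateSymplectic_muOfInvType ι₁ Φ) (Def45.RMuForm ι₁ (isConjugateSymplectic_muOfInvType ι₁ Φ)))))))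
    (h21 : shimura1998_thm21_4_casselman)
    (hD1 : ∀ (F : CMField) [IsGalois ℚ F], 6 ≤ Module.finrank ℚ F → ∀ (Φ : CMType F) (ι₁ : F →+* ℂ), ι₁ ∈ Φ.1 →
      ∀ (V : HermSpace3 F ι₁) (ε : Def411WeilCarriers.Eps ↥(maximalRealSubfield F) (imagUnitSq F))
        (χ : Def411WeilCarriers.Chi ↥(maximalRealSubfield F) F (IsCMField.complexConj F)) (v : IsDedekindDomain.HeightOneSpectrum (𝓞 ↥(maximalRealSubfield F))),
        LemD1_1AsPrinted
          (Def411WeilCarriers.localLemD1Data ↥(maximalRealSubfield F) F (IsCMField.complexConj F) 3 finProdFinEquiv (Matrix.diagonal V.diagEntries)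
            (complexConj_imagUnit F) (imagUnit_ne_zero F) (imagUnit_mul_self F) (realDiagonal_isSymm F V.diagEntries V.complexConj_diagEntries)
            (isUnit_det_realDiagonal F V.diagEntries V.complexConj_diagEntries V.diagEntries_ne_zero)
            (realDiagonal_map F V.diagEntries V.complexConj_diagEntries).symm (lineOf ↥(maximalRealSubfield F) (imagUnitSq F) ε)
            (OmegaMuSplitting.muLocalSplittings F ι₁ V Φ (lineOf ↥(maximalRealSubfield F) (imagUnitSq F) ε))
            (le_of_eq (Nat.mul_one 3).symm) (localMu F (OmegaMuSplitting.chiMu F ι₁ Φ))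
            (fun v x => norm_localMu F (OmegaMuSplitting.chiMu F ι₁ Φ) v (OmegaMuSplitting.chiMu_isUnitary F ι₁ Φ) x)
            (continuous_localMu F (OmegaMuSplitting.chiMu F ι₁ Φ))
            (fun v t => localMu_toLocalRing_eq_one_iff F (OmegaMuSplitting.chiMu F ι₁ Φ) v (OmegaMuSplitting.chiMu_isSplittingChar F ι₁ Φ) t)
            χ.1
            (Def411WeilCarriers.norm_chi_eq_one ↥(maximalRealSubfield F) F (IsCMField.complexConj F)
              (Algebra.IsQuadraticExtension.finrank_eq_two ↥(maximalRealSubfield F) F)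
              (UnitaryGroup.algEquiv_ne_one_of_apply_eq_neg ↥(maximalRealSubfield F) F (IsCMField.complexConj F) (complexConj_imagUnit F)
                (imagUnit_ne_zero F)) χ)
            χ.2.1 v))

    -- ───── Δ2 side: at the pinned dictionary of record of every Galois CM field of degree ≥ 6, every CM type `Φ` ─────
    (hbad : ∀ (F : HodgeCM.CMField) [IsGalois ℚ F] (h6 : 6 ≤ Module.finrank ℚ F) {ι₁ : F →+* ℂ} (V : HodgeCM.HermSpace3 F ι₁) (a₀ : RealScalar F)
      (Φ : CMType F) (hΦ : ι₁ ∈ Φ.1) (i : 𝕀⟦V, ι₁, a₀⟧), ℙ⟦V, ι₁, a₀, i⟧ → ¬ 𝔾⟦V, a₀, i⟧ → (𝔇⟦V, ι₁, a₀⟧).block i = ⊥)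
    (hΩ : ∀ (F : HodgeCM.CMField) [IsGalois ℚ F] (h6 : 6 ≤ Module.finrank ℚ F) {ι₁ : F →+* ℂ} (V : HodgeCM.HermSpace3 F ι₁) (a₀ : RealScalar F)
      (Φ : CMType F) (hΦ : ι₁ ∈ Φ.1),
      (NumberField.InfinitePlace.mk ι₁).embedding = ι₁ →
      ∃ (μ : ∀ i : 𝕀⟦V, ι₁, a₀⟧, ℙ⟦V, ι₁, a₀, i⟧ → 𝔾⟦V, a₀, i⟧ → (Literature.NumberTheory.Automorphic.IdeleClassGroup (F : Type) →ₜ* Circle))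
      (hμ : ∀ (i : 𝕀⟦V, ι₁, a₀⟧) (hi : ℙ⟦V, ι₁, a₀, i⟧) (hg : 𝔾⟦V, a₀, i⟧), IdeleClassGroup.IsConjugateSymplectic (F : Type) (μ i hi hg))
      (hw : ∀ (i : 𝕀⟦V, ι₁, a₀⟧) (hi : ℙ⟦V, ι₁, a₀, i⟧) (hg : 𝔾⟦V, a₀, i⟧), IdeleClassGroup.HasWeight (F : Type) (μ i hi hg) 1)
      (σ : ∀ (i : 𝕀⟦V, ι₁, a₀⟧) (hi : ℙ⟦V, ι₁, a₀, i⟧) (hg : 𝔾⟦V, a₀, i⟧), {χ : (𝕃⟦V, ι₁, a₀⟧ i).CharW // (𝕃⟦V, ι₁, a₀⟧ i).IsAutChar χ} → (toThm418Data _ ((𝕌⟦h, F, ι₁, V, Φ, a₀, i⟧).rest 𝔱⟦h, h6, F, ι₁, V, Φ, μ i hi hg, hμ i hi hg, hw i hi hg⟧)).AdmIndex)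
      (e : ∀ (i : 𝕀⟦V, ι₁, a₀⟧) (hi : ℙ⟦V, ι₁, a₀, i⟧) (hg : 𝔾⟦V, a₀, i⟧) (a : {χ : (𝕃⟦V, ι₁, a₀⟧ i).CharW // (𝕃⟦V, ι₁, a₀⟧ i).IsAutChar χ}), (𝕃⟦V, ι₁, a₀⟧ i).Ω (ιVE V) a.1 ≃ₗ[ℂ] (toThm418Data _ ((𝕌⟦h, F, ι₁, V, Φ, a₀, i⟧).rest 𝔱⟦h, h6, F, ι₁, V, Φ, μ i hi hg, hμ i hi hg, hw i hi hg⟧)).omegaAt (σ i hi hg a)),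
      (∀ (i : 𝕀⟦V, ι₁, a₀⟧) (hi : ℙ⟦V, ι₁, a₀, i⟧) (hg : 𝔾⟦V, a₀, i⟧), IdeleClassGroup.HasCMType (F : Type) (μ i hi hg) (𝕃⟦V, ι₁, a₀⟧ i).lineType) ∧ (∀ (i : 𝕀⟦V, ι₁, a₀⟧) (hi : ℙ⟦V, ι₁, a₀, i⟧) (hg : 𝔾⟦V, a₀, i⟧), Function.Injective (σ i hi hg)) ∧
      (∀ (i : 𝕀⟦V, ι₁, a₀⟧) (hi : ℙ⟦V, ι₁, a₀, i⟧) (hg : 𝔾⟦V, a₀, i⟧) (a : {χ : (𝕃⟦V, ι₁, a₀⟧ i).CharW // (𝕃⟦V, ι₁, a₀⟧ i).IsAutChar χ}) (g : ↥V.adelicFin) (m : (𝕃⟦V, ι₁, a₀⟧ i).Ω (ιVE V) a.1),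
          e i hi hg a (MonoidAlgebra.of ℂ ↥V.adelicFin g • m) = (toThm418Data _ ((𝕌⟦h, F, ι₁, V, Φ, a₀, i⟧).rest 𝔱⟦h, h6, F, ι₁, V, Φ, μ i hi hg, hμ i hi hg, hw i hi hg⟧)).rhoAt (σ i hi hg a) g (e i hi hg a m)))
    (hLiu' : ∀ (F : HodgeCM.CMField) [IsGalois ℚ F] (h6 : 6 ≤ Module.finrank ℚ F) {ι₁ : F →+* ℂ} (V : HodgeCM.HermSpace3 F ι₁) (a₀ : RealScalar F)
      (Φ : CMType F) (hΦ : ι₁ ∈ Φ.1) (i : 𝕀⟦V, ι₁, a₀⟧) (μ : Literature.NumberTheory.Automorphic.IdeleClassGroup (F : Type) →ₜ* Circle)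
      (hμ : IdeleClassGroup.IsConjugateSymplectic (F : Type) μ) (hw : IdeleClassGroup.HasWeight (F : Type) μ 1),
      Thm418AsPrinted (toThm418Data _ 𝔯⟦h, h6, F, ι₁, V, Φ, a₀, i, μ, hμ, hw⟧))
    (h411 : ∀ (F : HodgeCM.CMField) [IsGalois ℚ F] (h6 : 6 ≤ Module.finrank ℚ F) {ι₁ : F →+* ℂ} (V : HodgeCM.HermSpace3 F ι₁) (a₀ : RealScalar F)
      (Φ : CMType F) (hΦ : ι₁ ∈ Φ.1) (i : 𝕀⟦V, ι₁, a₀⟧) (μ : Literature.NumberTheory.Automorphic.IdeleClassGroup (F : Type) →ₜ* Circle)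
      (hμ : IdeleClassGroup.IsConjugateSymplectic (F : Type) μ) (hw : IdeleClassGroup.HasWeight (F : Type) μ 1),
      Def411AsPrinted (toThm418Data _ 𝔯⟦h, h6, F, ι₁, V, Φ, a₀, i, μ, hμ, hw⟧))
    (h413 : ∀ (F : HodgeCM.CMField) [IsGalois ℚ F] (h6 : 6 ≤ Module.finrank ℚ F) {ι₁ : F →+* ℂ} (V : HodgeCM.HermSpace3 F ι₁) (a₀ : RealScalar F)
      (Φ : CMType F) (hΦ : ι₁ ∈ Φ.1) (i : 𝕀⟦V, ι₁, a₀⟧), Prop413AsPrinted ((𝕌⟦h, F, ι₁, V, Φ, a₀, i⟧).prop413Data (𝔇⟦V, ι₁, a₀⟧).H))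
    (hμsep : ∀ (F : HodgeCM.CMField) [IsGalois ℚ F] (h6 : 6 ≤ Module.finrank ℚ F) {ι₁ : F →+* ℂ} (V : HodgeCM.HermSpace3 F ι₁) (a₀ : RealScalar F)
      (Φ : CMType F) (hΦ : ι₁ ∈ Φ.1) (i : 𝕀⟦V, ι₁, a₀⟧) (s t : ((𝕌⟦h, F, ι₁, V, Φ, a₀, i⟧).prop413Data (𝔇⟦V, ι₁, a₀⟧).H).AdmTriple), Nontrivial (((𝕌⟦h, F, ι₁, V, Φ, a₀, i⟧).prop413Data (𝔇⟦V, ι₁, a₀⟧).H).omegaAt s) →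
      (∃ f : ((𝕌⟦h, F, ι₁, V, Φ, a₀, i⟧).prop413Data (𝔇⟦V, ι₁, a₀⟧).H).omegaAt s ≃ₗ[ℂ] ((𝕌⟦h, F, ι₁, V, Φ, a₀, i⟧).prop413Data (𝔇⟦V, ι₁, a₀⟧).H).omegaAt t,
        ∀ (g : ↥V.adelicFin) (v : ((𝕌⟦h, F, ι₁, V, Φ, a₀, i⟧).prop413Data (𝔇⟦V, ι₁, a₀⟧).H).omegaAt s), f (((𝕌⟦h, F, ι₁, V, Φ, a₀, i⟧).prop413Data (𝔇⟦V, ι₁, a₀⟧).H).rhoAt s g v) = ((𝕌⟦h, F, ι₁, V, Φ, a₀, i⟧).prop413Data (𝔇⟦V, ι₁, a₀⟧).H).rhoAt t g (f v)) → s.1.μ = t.1.μ)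
    (hD1' : ∀ (F : HodgeCM.CMField) [IsGalois ℚ F] (h6 : 6 ≤ Module.finrank ℚ F) {ι₁ : F →+* ℂ} (V : HodgeCM.HermSpace3 F ι₁) (a₀ : RealScalar F)
      (Φ : CMType F) (hΦ : ι₁ ∈ Φ.1) (i : 𝕀⟦V, ι₁, a₀⟧) (μ : Literature.NumberTheory.Automorphic.IdeleClassGroup (F : Type) →ₜ* Circle)
      (hμ : IdeleClassGroup.IsConjugateSymplectic (F : Type) μ) (hw : IdeleClassGroup.HasWeight (F : Type) μ 1) (hΦμ : IdeleClassGroup.HasCMType (F : Type) μ (𝕃⟦V, ι₁, a₀⟧ i).lineType)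
      (j : (toThm418Data _ 𝔯⟦h, h6, F, ι₁, V, Φ, a₀, i, μ, hμ, hw⟧).AdmIndex) (v : IsDedekindDomain.HeightOneSpectrum (𝓞 ↥(maximalRealSubfield (F : Type)))),
      LemD1_1AsPrinted
        (Def411WeilCarriers.localLemD1Data ↥(maximalRealSubfield (F : Type)) (F : Type) (IsCMField.complexConj (F : Type)) 3 e₁
          (Matrix.diagonal (frameD V)) (complexConj_imagUnit (F : Type)) (imagUnit_ne_zero (F : Type)) (imagUnit_mul_self (F : Type))
          (realDiagonal_isSymm (F : Type) (frameD V) (frameD_real V)) (isUnit_det_realDiagonal (F : Type) (frameD V) (frameD_real V) (frameD_ne V))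
          (realDiagonal_map (F : Type) (frameD V) (frameD_real V)).symm ((𝕣⟦F, a₀, i⟧).toFun j.1.1)
          (OmegaChiSplitting.chiLocalSplittingsD ⟨HodgeCM.CMField.K F⟩ e₁ (frameD V) (frameD_real V) (frameD_ne V) (toHeckeCharacter (F : Type) μ)
            ((isOscillatorChar_toHeckeCharacter_iff μ).mpr hμ) ((𝕣⟦F, a₀, i⟧).toFun j.1.1))
          (le_refl 3) (localMu (F : Type) (toHeckeCharacter (F : Type) μ))
          (fun v x => norm_localMu (F : Type) (toHeckeCharacter (F : Type) μ) v (isUnitary_toHeckeCharacter (F : Type) μ) x)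
          (continuous_localMu (F : Type) (toHeckeCharacter (F : Type) μ))
          (fun v t => localMu_toLocalRing_eq_one_iff (F : Type) (toHeckeCharacter (F : Type) μ) v ((isOscillatorChar_toHeckeCharacter_iff μ).mpr hμ) t)
          j.1.2.1
          (Def411WeilCarriers.norm_chi_eq_one ↥(maximalRealSubfield (F : Type)) (F : Type) (IsCMField.complexConj (F : Type))
            (Algebra.IsQuadraticExtension.finrank_eq_two ↥(maximalRealSubfield (F : Type)) (F : Type))
            (UnitaryGroup.algEquiv_ne_one_of_apply_eq_neg ↥(maximalRealSubfield (F : Type)) (F : Type) (IsCMField.complexConj (F : Type))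
              (complexConj_imagUnit (F : Type)) (imagUnit_ne_zero (F : Type))) j.1.2)
          j.1.2.2.1 v))
    (M : ∀ (F : HodgeCM.CMField) [IsGalois ℚ F] (h6 : 6 ≤ Module.finrank ℚ F) {ι₁ : F →+* ℂ} (V : HodgeCM.HermSpace3 F ι₁) (a₀ : RealScalar F)
      (Φ : CMType F) (hΦ : ι₁ ∈ Φ.1) (i : 𝕀⟦V, ι₁, a₀⟧) (μ : Literature.NumberTheory.Automorphic.IdeleClassGroup (F : Type) →ₜ* Circle)
      (hμ : IdeleClassGroup.IsConjugateSymplectic (F : Type) μ) (hw : IdeleClassGroup.HasWeight (F : Type) μ 1) (hΦμ : IdeleClassGroup.HasCMType (F : Type) μ (𝕃⟦V, ι₁, a₀⟧ i).lineType),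
      (toThm418Data _ ((𝕌⟦h, F, ι₁, V, Φ, a₀, i⟧).rest 𝔱⟦h, h6, F, ι₁, V, Φ, μ, hμ, hw⟧)).Map43RationalData)
    (jH : ∀ (F : HodgeCM.CMField) [IsGalois ℚ F] (h6 : 6 ≤ Module.finrank ℚ F) {ι₁ : F →+* ℂ} (V : HodgeCM.HermSpace3 F ι₁) (a₀ : RealScalar F)
      (Φ : CMType F) (hΦ : ι₁ ∈ Φ.1) (i : 𝕀⟦V, ι₁, a₀⟧) (μ : Literature.NumberTheory.Automorphic.IdeleClassGroup (F : Type) →ₜ* Circle)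
      (hμ : IdeleClassGroup.IsConjugateSymplectic (F : Type) μ) (hw : IdeleClassGroup.HasWeight (F : Type) μ 1) (hΦμ : IdeleClassGroup.HasCMType (F : Type) μ (𝕃⟦V, ι₁, a₀⟧ i).lineType),
      (M F h6 V a₀ Φ hΦ i μ hμ hw hΦμ).HB →ₗ[ℂ] (𝔇⟦V, ι₁, a₀⟧).H)
    (hjHinj : ∀ (F : HodgeCM.CMField) [IsGalois ℚ F] (h6 : 6 ≤ Module.finrank ℚ F) {ι₁ : F →+* ℂ} (V : HodgeCM.HermSpace3 F ι₁) (a₀ : RealScalar F)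
      (Φ : CMType F) (hΦ : ι₁ ∈ Φ.1) (i : 𝕀⟦V, ι₁, a₀⟧) (μ : Literature.NumberTheory.Automorphic.IdeleClassGroup (F : Type) →ₜ* Circle)
      (hμ : IdeleClassGroup.IsConjugateSymplectic (F : Type) μ) (hw : IdeleClassGroup.HasWeight (F : Type) μ 1) (hΦμ : IdeleClassGroup.HasCMType (F : Type) μ (𝕃⟦V, ι₁, a₀⟧ i).lineType),
      Function.Injective (jH F h6 V a₀ Φ hΦ i μ hμ hw hΦμ))
    (hjH : ∀ (F : HodgeCM.CMField) [IsGalois ℚ F] (h6 : 6 ≤ Module.finrank ℚ F) {ι₁ : F →+* ℂ} (V : HodgeCM.HermSpace3 F ι₁) (a₀ : RealScalar F)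
      (Φ : CMType F) (hΦ : ι₁ ∈ Φ.1) (i : 𝕀⟦V, ι₁, a₀⟧) (μ : Literature.NumberTheory.Automorphic.IdeleClassGroup (F : Type) →ₜ* Circle)
      (hμ : IdeleClassGroup.IsConjugateSymplectic (F : Type) μ) (hw : IdeleClassGroup.HasWeight (F : Type) μ 1) (hΦμ : IdeleClassGroup.HasCMType (F : Type) μ (𝕃⟦V, ι₁, a₀⟧ i).lineType) (g : ↥V.adelicFin) (x : (M F h6 V a₀ Φ hΦ i μ hμ hw hΦμ).HB),
      jH F h6 V a₀ Φ hΦ i μ hμ hw hΦμ ((M F h6 V a₀ Φ hΦ i μ hμ hw hΦμ).ρB g x) = MonoidAlgebra.of ℂ ↥V.adelicFin g • jH F h6 V a₀ Φ hΦ i μ hμ hw hΦμ x)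
    (pieces : ∀ (F : HodgeCM.CMField) [IsGalois ℚ F] (h6 : 6 ≤ Module.finrank ℚ F) {ι₁ : F →+* ℂ} (V : HodgeCM.HermSpace3 F ι₁) (a₀ : RealScalar F)
      (Φ : CMType F) (hΦ : ι₁ ∈ Φ.1) (i : 𝕀⟦V, ι₁, a₀⟧) (μ : Literature.NumberTheory.Automorphic.IdeleClassGroup (F : Type) →ₜ* Circle)
      (hμ : IdeleClassGroup.IsConjugateSymplectic (F : Type) μ) (hw : IdeleClassGroup.HasWeight (F : Type) μ 1) (hΦμ : IdeleClassGroup.HasCMType (F : Type) μ (𝕃⟦V, ι₁, a₀⟧ i).lineType) (K : HodgeCM.Level V),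
      K ≤ HodgeCM.Level.capThree (V := V) ((ℭ⟦h, F, ι₁, V, Φ⟧).S.K₀.1 : Subgroup ↥V.adelicFin) (ℭ⟦h, F, ι₁, V, Φ⟧).S.K₀.2.1 →
      HcmPieces.{0, 1, 0} (toThm418Data _ ((𝕌⟦h, F, ι₁, V, Φ, a₀, i⟧).rest 𝔱⟦h, h6, F, ι₁, V, Φ, μ, hμ, hw⟧)) (M F h6 V a₀ Φ hΦ i μ hμ hw hΦμ) (𝔇⟦V, ι₁, a₀⟧).H (jH F h6 V a₀ Φ hΦ i μ hμ hw hΦμ) K.K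
        ((HodgeCM.Model.picardCMUniverse exists_isReal_hodgeModel_holds hodgePQ_independent_of_hodgeModel_holds
            BallQuotient.ballQuotientUniformised_holds
            (cmAbelianVarietyRealised_of_eigenbasis exists_isReal_hodgeModel_holds hodgePQ_independent_of_hodgeModel_holds
              cmAbelianVarietyEigenbasisRealised_holds)).CohC
          ((HodgeCM.Model.picardCMUniverse exists_isReal_hodgeModel_holds hodgePQ_independent_of_hodgeModel_holds
            BallQuotient.ballQuotientUniformised_holds
            (cmAbelianVarietyRealised_of_eigenbasis exists_isReal_hodgeModel_holds hodgePQ_independent_of_hodgeModel_holds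
              cmAbelianVarietyEigenbasisRealised_holds)).pms F ι₁ V K) 1)
        (resTotal exists_isReal_hodgeModel_holds hodgePQ_independent_of_hodgeModel_holds
          (ballQuotientUniformisedDatum_of BallQuotient.ballQuotientUniformised_holds)
          (cmAbelianVarietyRealised_of_eigenbasis exists_isReal_hodgeModel_holds hodgePQ_independent_of_hodgeModel_holds
            cmAbelianVarietyEigenbasisRealised_holds)
          Literature.NumberTheory.Transcendental.arapura2012_cor_15_4_6_holds K)
        ((𝔇⟦V, ι₁, a₀⟧).cmClasses K i)) :
    HC_CM :=
  hc_cm_of_port_meeting_rec_local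
    (fun F hG h6 {ι₁} V hV a₀ => by
      haveI : IsGalois ℚ F := hG
      -- a CM type of `F` containing `ι₁` ([Liu21] Def. 4.3 `Φ_e` at the constant ∞-type `e = −1`; `ι₁` is canonical by `hV`)
      let Φ : CMType F := Literature.NumberTheory.Automorphic.IdeleClassGroup.cmTypeOf (F : Type) (fun _ => (-1 : ℤ)) (fun _ => by decide)
      have hΦ : ι₁ ∈ Φ.1 := hV ▸ Literature.NumberTheory.Automorphic.IdeleClassGroup.embedding_mem_cmTypeOf_iff.2 (by decide)
      exact thm418C_indexOfRecord_of_pins F h6 V a₀ h Φ (hbad F h6 V a₀ Φ hΦ) (hΩ F h6 V a₀ Φ hΦ hV) (hLiu' F h6 V a₀ Φ hΦ) (h411 F h6 V a₀ Φ hΦ) (h413 F h6 V a₀ Φ hΦ) (hμsep F h6 V a₀ Φ hΦ) (hD1' F h6 V a₀ Φ hΦ) (M F h6 V a₀ Φ hΦ) (jH F h6 V a₀ Φ hΦ) (hjHinj F h6 V a₀ Φ hΦ) (hjH F h6 V a₀ Φ hΦ) (pieces F h6 V a₀ Φ hΦ))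
    h hLiu h21 hD1

end Summit.HodgeConjecture.CorCM.PortJoin

end
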